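import Summits.KontsevichZagierPeriods.KontsevichZagierPeriods.Theses.LinRedNormalForm
import Summits.KontsevichZagierPeriods.KontsevichZagierPeriods.Theorems.LinRedNormalFormHoffmanIndependenceZagierEquivalence
import Literature.NumberTheory.Transcendental.MultipleZetaStuffle
import Literature.NumberTheory.Transcendental.MultipleZetaValuesProofs
import Mathlib.RingTheory.Algebraic.Basic
import Mathlib.LinearAlgebra.DFinsupp
import Mathlib.Algebra.Module.Torsion.Field

/-!
# Crux `HoffmanIndependence` (stmt-KontsevichZagierPeriods-15045), line `weight_split` —
# Goncharov's grading conjecture alone makes every non-zero MZV of positive weight transcendental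

The line `weight_split` writes the crux (`ℚ`-linear independence of ALL real Hoffman values) as
the conjunction of a GRADING half (`iSupIndep hoffmanSpan`, Goncharov's weight-grading conjecture
on the Hoffman spans) and an IN-WEIGHT half. This file records the strength of the grading half
alone, for the full MZV weight spaces `𝒵_w = mzvSpace w`:

* `stub_transcendental_of_grading` — under `MZVWeightGradingConjecture` (`iSupIndep mzvSpace`,
  an OPEN conjecture used here only as a hypothesis) every non-zero `x ∈ 𝒵_w` with `w ≠ 0` is
  transcendental over `ℚ`. Proof: the powers `xⁿ` lie in `𝒵_{n w}` (`mem_mzvSpace_mul_holds`, the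
  stuffle product, and `𝒵₀ = ℚ · 1`), the weights `n w` are pairwise distinct, so the `xⁿ` are
  non-zero members of independent subspaces, hence `ℚ`-linearly independent
  (`iSupIndep.linearIndependent`); a polynomial relation `∑ aₙ xⁿ = 0` then has all `aₙ = 0`.
* `transcendental_multipleZeta_of_gradingConjecture` — in particular every `ζ(s)`, `s ≠ ∅`
  admissible, is transcendental under the conjecture (`ζ(s) > 0` lies in `𝒵_{|s|}`, `|s| ≥ 2`).
* `transcendental_multipleZeta_of_hoffmanIndependence` — crux + Brown's theorem
  (`hoffmanSpan_eq_mzvSpace`) give the grading conjecture (`gradingConjecture_of_hoffmanIndependence`),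
  hence the transcendence of every Hoffman value `ζ(u)`, `u ≠ ∅`, and of every `ζ(k)`, `k ≥ 2`
  (`transcendental_multipleZeta_singleton_of_hoffmanIndependence`; open already for `k = 3`).

Nothing here closes the item; no new definitions. [cite: GoncharovECM2001, Conjecture 1.1]
[cite: Waldschmidt2004, §3]
-/

noncomputable section

namespace Summit.KontsevichZagierPeriods.LinRedNormalForm.HoffmanIndependence

open Literature.NumberTheory.Transcendental MZV
open Summit.KontsevichZagierPeriods.KontsevichZagierPeriods.Theses.LinRedNormalForm (HoffmanIndependence)

/-- Powers of an element of `𝒵_w` climb the weight filtration: `x ∈ 𝒵_w ⟹ xⁿ ∈ 𝒵_{n w}`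
(`x⁰ = 1 ∈ 𝒵₀ = ℚ · 1`, and `𝒵_a · 𝒵_b ⊆ 𝒵_{a+b}` by the stuffle product,
`mem_mzvSpace_mul_holds`). [cite: Hoffman1997] -/
theorem pow_mem_mzvSpace_mul {w : ℕ} {x : ℝ} (hx : x ∈ mzvSpace w) (n : ℕ) :
    x ^ n ∈ mzvSpace (n * w) := by
  induction n with
  | zero =>
    rw [pow_zero, Nat.zero_mul, mzvSpace_zero_eq]
    exact Submodule.mem_span_singleton_self (1 : ℝ)
  | succ n ih =>
    rw [pow_succ, Nat.succ_mul]
    exact mem_mzvSpace_mul_holds ih hx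

/-- Under Goncharov's grading conjecture the subspaces `𝒵_0, 𝒵_w, 𝒵_{2w}, …` along an arithmetic
progression of positive difference `w` are still independent (re-indexing an independent family
along the injection `n ↦ n w`). [cite: GoncharovECM2001, Conjecture 1.1] -/
theorem iSupIndep_mzvSpace_mul_of_gradingConjecture (hG : MZVWeightGradingConjecture) {w : ℕ}
    (hw : w ≠ 0) : iSupIndep fun n : ℕ => mzvSpace (n * w) :=
  iSupIndep.comp (f := fun n : ℕ => n * w) hG (mul_left_injective₀ hw)

/-- Under Goncharov's grading conjecture the powers `1, x, x², …` of a non-zero element `x` of a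
weight space `𝒵_w` of positive weight are `ℚ`-linearly independent: they are non-zero members of
the independent subspaces `𝒵_{n w}`. [cite: GoncharovECM2001, Conjecture 1.1] -/
theorem linearIndependent_pow_of_gradingConjecture (hG : MZVWeightGradingConjecture) {w : ℕ}
    {x : ℝ} (hw : w ≠ 0) (hx : x ∈ mzvSpace w) (hx0 : x ≠ 0) :
    LinearIndependent ℚ fun n : ℕ => x ^ n :=
  (iSupIndep_mzvSpace_mul_of_gradingConjecture hG hw).linearIndependent _
    (pow_mem_mzvSpace_mul hx) fun n => pow_ne_zero n hx0

/-- **Goncharov's grading conjecture ⟹ transcendence of every non-zero MZV of positive weight.**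
If `x ∈ 𝒵_w`, `w ≠ 0`, `x ≠ 0`, satisfied `∑ aₙ xⁿ = 0` with `aₙ ∈ ℚ` not all zero, this would be a
`ℚ`-linear relation among the elements `aₙ xⁿ ∈ 𝒵_{n w}` of pairwise different weights, so each
`aₙ xⁿ = 0` and each `aₙ = 0`. (Waldschmidt 2004, §3: Goncharov's conjecture contains the
transcendence of every `ζ(s)`, far beyond what is known.)
[cite: GoncharovECM2001, Conjecture 1.1] [cite: Waldschmidt2004, §3] -/
theorem stub_transcendental_of_grading :
    MZVWeightGradingConjecture →
      ∀ {w : ℕ} {x : ℝ}, w ≠ 0 → x ∈ mzvSpace w → x ≠ 0 → Transcendental ℚ x := by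
  intro hG w x hw hx hx0
  have hli := linearIndependent_pow_of_gradingConjecture hG hw hx hx0
  rw [transcendental_iff]
  intro p hp
  rw [Polynomial.aeval_eq_sum_range] at hp
  have hcoeff := linearIndependent_iff'.1 hli _ (fun i => p.coeff i) hp
  ext i
  rw [Polynomial.coeff_zero]
  by_cases hi : i ∈ Finset.range (p.natDegree + 1)
  · exact hcoeff i hi
  · exact Polynomial.coeff_eq_zero_of_natDegree_lt
      (by rw [Finset.mem_range] at hi; omega)

/-- Under Goncharov's grading conjecture every multiple zeta value `ζ(s)` of a non-empty admissible
index is transcendental: it is positive (`multipleZeta_pos_of_isAdmissible_holds`) and lies in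
`𝒵_{|s|}` with `|s| ≥ 2`. [cite: GoncharovECM2001, Conjecture 1.1] [cite: Waldschmidt2004, §3] -/
theorem transcendental_multipleZeta_of_gradingConjecture (hG : MZVWeightGradingConjecture)
    {s : List ℕ} (hs : IsAdmissible s) (hne : s ≠ []) : Transcendental ℚ (multipleZeta s) :=
  stub_transcendental_of_grading hG (w := weight s)
    (by have := two_le_weight_of_isAdmissible hs hne; omega)
    (Submodule.subset_span ⟨s, hs, rfl, rfl⟩) (multipleZeta_pos_of_isAdmissible_holds hs).ne'

/-- **Crux + Brown ⟹ every Hoffman value `ζ(u)`, `u ≠ ∅`, is transcendental** (open already for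
`u = (3)`): the crux with Brown's theorem `hoffmanSpan_eq_mzvSpace` gives Goncharov's grading
conjecture (`gradingConjecture_of_hoffmanIndependence`), and a Hoffman index is admissible.
[cite: GoncharovECM2001, Conjecture 1.1] [cite: Brown2012, Theorem 1.1] -/
theorem transcendental_multipleZeta_of_hoffmanIndependence (h : HoffmanIndependence)
    (hB : hoffmanSpan_eq_mzvSpace) {u : List ℕ} (hu : IsHoffman u) (hne : u ≠ []) :
    Transcendental ℚ (multipleZeta u) :=
  transcendental_multipleZeta_of_gradingConjecture (gradingConjecture_of_hoffmanIndependence h hB)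
    hu.isAdmissible hne

/-- **Crux + Brown ⟹ `ζ(k)` is transcendental for every `k ≥ 2`** — in particular `ζ(3), ζ(5), ζ(7), …`
(for odd `k` not even the irrationality is known beyond `k = 3`).
[cite: GoncharovECM2001, Conjecture 1.1] [cite: Waldschmidt2004, §3] -/
theorem transcendental_multipleZeta_singleton_of_hoffmanIndependence (h : HoffmanIndependence)
    (hB : hoffmanSpan_eq_mzvSpace) {k : ℕ} (hk : 2 ≤ k) : Transcendental ℚ (multipleZeta [k]) :=
  transcendental_multipleZeta_of_gradingConjecture (gradingConjecture_of_hoffmanIndependence h hB)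
    ⟨fun i hi => by simp only [List.mem_singleton] at hi; omega, fun _ => by simpa using hk⟩
    (List.cons_ne_nil k [])

end Summit.KontsevichZagierPeriods.LinRedNormalForm.HoffmanIndependence
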